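import Summits.QuantumFields.YangMills.Theorems.BalabanLadderNTStrongCouplingCumulantAlgebra
import HarnessLib

/-!
# Crux `NT` (stmt-QuantumFields-19353), strong-coupling rung: TRILINEAR EXPANSION OF THE THIRD CUMULANT

Helper file of ym-idea-8 (g5, lens "dual"; instrument F4c for the NT non-Gaussian first rung `SkewFloorSU2`,
`Cruxes/NT/Lines/strong_coupling_rung.lean`, LEAD `ym-spine-19353-p1` g17 — item (D) of its 15:16Z sizing: the
free-side assembly of the `6³` plaquette triples).  Pure measure-theoretic bookkeeping over an arbitrary probability
space, continuing `…CumulantAlgebra`: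

* `k3_sum₃` — full trilinearity: for bounded measurable finite families `f, g, h`,
  `K₃(Σ_A f, Σ_B g, Σ_C h) = Σ_{A×B×C} K₃(f_i, g_j, h_k)` (five-term `torusK3` shape on both sides);
* `k3_sum₃_add_const` — the same with constant shifts in each slot (`K₃` is shift-invariant), which is the
  form the action density `dens = Σ_{6 planes} φ^c + 6m` produces.

HONEST FRAMING: elementary probability bookkeeping; nothing about Yang–Mills is proved here; NT `0/1`; no summit
is proved by a line.  [folklore]
-/

noncomputable section

open MeasureTheory

open Summit.QuantumFields.YangMills.Theorems.ContinuumLegGivenGap (rpShift_integrable_mul)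
open Summit.QuantumFields.YangMills.Theorems.SelfNormalisedSkewness.Negative (integrable_of_abs_le_const)

namespace Summit.QuantumFields.YangMills.Cruxes.NT.StrongCouplingRung.CumulantAlgebra

variable {Ω : Type*} [MeasurableSpace Ω] {μ : Measure Ω}

omit [MeasurableSpace Ω] in
/-- A finite sum of functions bounded by `M` is bounded by `#s · M`. [folklore] -/
theorem abs_finset_sum_le_card_mul {ι : Type*} (s : Finset ι) (f : ι → Ω → ℝ) {M : ℝ}
    (hfb : ∀ i ∈ s, ∀ ω, |f i ω| ≤ M) (ω : Ω) : |∑ i ∈ s, f i ω| ≤ s.card * M :=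
  (Finset.abs_sum_le_sum_abs _ _).trans
    ((Finset.sum_le_sum fun i hi => hfb i hi ω).trans (by rw [Finset.sum_const, nsmul_eq_mul]))

/-- **Trilinearity of the third cumulant**: for bounded measurable finite families under a finite measure,
`K₃(Σ_A f, Σ_B g, Σ_C h) = Σ_i Σ_j Σ_k K₃(f_i, g_j, h_k)` (five-term shape). [folklore] -/
theorem k3_sum₃ [IsFiniteMeasure μ] {ι κ ν : Type*} (A : Finset ι) (B : Finset κ) (C : Finset ν)
    (f : ι → Ω → ℝ) (g : κ → Ω → ℝ) (h : ν → Ω → ℝ)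
    (hf : ∀ i ∈ A, Measurable (f i)) (hg : ∀ j ∈ B, Measurable (g j)) (hh : ∀ k ∈ C, Measurable (h k))
    {M : ℝ} (hfb : ∀ i ∈ A, ∀ ω, |f i ω| ≤ M) (hgb : ∀ j ∈ B, ∀ ω, |g j ω| ≤ M)
    (hhb : ∀ k ∈ C, ∀ ω, |h k ω| ≤ M) :
    (∫ ω, (∑ i ∈ A, f i ω) * (∑ j ∈ B, g j ω) * (∑ k ∈ C, h k ω) ∂μ) -
        (∫ ω, ∑ i ∈ A, f i ω ∂μ) * (∫ ω, (∑ j ∈ B, g j ω) * (∑ k ∈ C, h k ω) ∂μ) -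
        (∫ ω, ∑ j ∈ B, g j ω ∂μ) * (∫ ω, (∑ i ∈ A, f i ω) * (∑ k ∈ C, h k ω) ∂μ) -
        (∫ ω, ∑ k ∈ C, h k ω ∂μ) * (∫ ω, (∑ i ∈ A, f i ω) * (∑ j ∈ B, g j ω) ∂μ) +
        2 * ((∫ ω, ∑ i ∈ A, f i ω ∂μ) * (∫ ω, ∑ j ∈ B, g j ω ∂μ) * (∫ ω, ∑ k ∈ C, h k ω ∂μ)) =
      ∑ i ∈ A, ∑ j ∈ B, ∑ k ∈ C,
        ((∫ ω, f i ω * g j ω * h k ω ∂μ) - (∫ ω, f i ω ∂μ) * (∫ ω, g j ω * h k ω ∂μ) -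
          (∫ ω, g j ω ∂μ) * (∫ ω, f i ω * h k ω ∂μ) - (∫ ω, h k ω ∂μ) * (∫ ω, f i ω * g j ω ∂μ) +
          2 * ((∫ ω, f i ω ∂μ) * (∫ ω, g j ω ∂μ) * (∫ ω, h k ω ∂μ))) := by
  have hGm : Measurable fun ω => ∑ j ∈ B, g j ω := Finset.measurable_sum B hg
  have hHm : Measurable fun ω => ∑ k ∈ C, h k ω := Finset.measurable_sum C hh
  have hGb : ∀ ω, |∑ j ∈ B, g j ω| ≤ B.card * M := abs_finset_sum_le_card_mul B g hgb
  have hHb : ∀ ω, |∑ k ∈ C, h k ω| ≤ C.card * M := abs_finset_sum_le_card_mul C h hhb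
  -- slot 1
  have e1 :
      (∫ ω, (∑ i ∈ A, f i ω) * (∑ j ∈ B, g j ω) * (∑ k ∈ C, h k ω) ∂μ) -
          (∫ ω, ∑ i ∈ A, f i ω ∂μ) * (∫ ω, (∑ j ∈ B, g j ω) * (∑ k ∈ C, h k ω) ∂μ) -
          (∫ ω, ∑ j ∈ B, g j ω ∂μ) * (∫ ω, (∑ i ∈ A, f i ω) * (∑ k ∈ C, h k ω) ∂μ) -
          (∫ ω, ∑ k ∈ C, h k ω ∂μ) * (∫ ω, (∑ i ∈ A, f i ω) * (∑ j ∈ B, g j ω) ∂μ) +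
          2 * ((∫ ω, ∑ i ∈ A, f i ω ∂μ) * (∫ ω, ∑ j ∈ B, g j ω ∂μ) * (∫ ω, ∑ k ∈ C, h k ω ∂μ)) =
        ∑ i ∈ A, ((∫ ω, f i ω * (∑ j ∈ B, g j ω) * (∑ k ∈ C, h k ω) ∂μ) -
          (∫ ω, f i ω ∂μ) * (∫ ω, (∑ j ∈ B, g j ω) * (∑ k ∈ C, h k ω) ∂μ) -
          (∫ ω, ∑ j ∈ B, g j ω ∂μ) * (∫ ω, f i ω * (∑ k ∈ C, h k ω) ∂μ) -
          (∫ ω, ∑ k ∈ C, h k ω ∂μ) * (∫ ω, f i ω * (∑ j ∈ B, g j ω) ∂μ) +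
          2 * ((∫ ω, f i ω ∂μ) * (∫ ω, ∑ j ∈ B, g j ω ∂μ) * (∫ ω, ∑ k ∈ C, h k ω ∂μ))) :=
    k3_sum_left A f (fun ω => ∑ j ∈ B, g j ω) (fun ω => ∑ k ∈ C, h k ω)
      (fun i hi => integrable_of_abs_le_const (hf i hi) (hfb i hi))
      (fun i hi => rpShift_integrable_mul (hf i hi) hGm (hfb i hi) hGb)
      (fun i hi => rpShift_integrable_mul (hf i hi) hHm (hfb i hi) hHb)
      (fun i hi => integrable_mul₃_of_bdd (hf i hi) hGm hHm (hfb i hi) hGb hHb)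
  rw [e1]
  refine Finset.sum_congr rfl fun i hi => ?_
  -- slot 2
  have e2 :
      (∫ ω, f i ω * (∑ j ∈ B, g j ω) * (∑ k ∈ C, h k ω) ∂μ) -
          (∫ ω, f i ω ∂μ) * (∫ ω, (∑ j ∈ B, g j ω) * (∑ k ∈ C, h k ω) ∂μ) -
          (∫ ω, ∑ j ∈ B, g j ω ∂μ) * (∫ ω, f i ω * (∑ k ∈ C, h k ω) ∂μ) -
          (∫ ω, ∑ k ∈ C, h k ω ∂μ) * (∫ ω, f i ω * (∑ j ∈ B, g j ω) ∂μ) +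
          2 * ((∫ ω, f i ω ∂μ) * (∫ ω, ∑ j ∈ B, g j ω ∂μ) * (∫ ω, ∑ k ∈ C, h k ω ∂μ)) =
        ∑ j ∈ B, ((∫ ω, f i ω * g j ω * (∑ k ∈ C, h k ω) ∂μ) -
          (∫ ω, f i ω ∂μ) * (∫ ω, g j ω * (∑ k ∈ C, h k ω) ∂μ) -
          (∫ ω, g j ω ∂μ) * (∫ ω, f i ω * (∑ k ∈ C, h k ω) ∂μ) -
          (∫ ω, ∑ k ∈ C, h k ω ∂μ) * (∫ ω, f i ω * g j ω ∂μ) +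
          2 * ((∫ ω, f i ω ∂μ) * (∫ ω, g j ω ∂μ) * (∫ ω, ∑ k ∈ C, h k ω ∂μ))) :=
    k3_sum_mid B (f i) g (fun ω => ∑ k ∈ C, h k ω)
      (fun j hj => integrable_of_abs_le_const (hg j hj) (hgb j hj))
      (fun j hj => rpShift_integrable_mul (hf i hi) (hg j hj) (hfb i hi) (hgb j hj))
      (fun j hj => rpShift_integrable_mul (hg j hj) hHm (hgb j hj) hHb)
      (fun j hj => integrable_mul₃_of_bdd (hf i hi) (hg j hj) hHm (hfb i hi) (hgb j hj) hHb)
  rw [e2]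
  refine Finset.sum_congr rfl fun j hj => ?_
  -- slot 3
  exact k3_sum_right C (f i) (g j) h
    (fun k hk => integrable_of_abs_le_const (hh k hk) (hhb k hk))
    (fun k hk => rpShift_integrable_mul (hf i hi) (hh k hk) (hfb i hi) (hhb k hk))
    (fun k hk => rpShift_integrable_mul (hg j hj) (hh k hk) (hgb j hj) (hhb k hk))
    (fun k hk => integrable_mul₃_of_bdd (hf i hi) (hg j hj) (hh k hk) (hfb i hi) (hgb j hj) (hhb k hk))

/-- **Trilinearity with constant shifts**: under a probability measure,
`K₃(Σ_A f + a, Σ_B g + b, Σ_C h + c) = Σ_i Σ_j Σ_k K₃(f_i, g_j, h_k)` for bounded measurable finite families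
(the shape produced by `dens = Σ_{planes} φ^c + 6m`). [folklore] -/
theorem k3_sum₃_add_const [IsProbabilityMeasure μ] {ι κ ν : Type*} (A : Finset ι) (B : Finset κ)
    (C : Finset ν) (f : ι → Ω → ℝ) (g : κ → Ω → ℝ) (h : ν → Ω → ℝ)
    (hf : ∀ i ∈ A, Measurable (f i)) (hg : ∀ j ∈ B, Measurable (g j)) (hh : ∀ k ∈ C, Measurable (h k))
    {M : ℝ} (hM : 0 ≤ M) (hfb : ∀ i ∈ A, ∀ ω, |f i ω| ≤ M) (hgb : ∀ j ∈ B, ∀ ω, |g j ω| ≤ M)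
    (hhb : ∀ k ∈ C, ∀ ω, |h k ω| ≤ M) (a b c : ℝ) :
    (∫ ω, ((∑ i ∈ A, f i ω) + a) * ((∑ j ∈ B, g j ω) + b) * ((∑ k ∈ C, h k ω) + c) ∂μ) -
        (∫ ω, (∑ i ∈ A, f i ω) + a ∂μ) * (∫ ω, ((∑ j ∈ B, g j ω) + b) * ((∑ k ∈ C, h k ω) + c) ∂μ) -
        (∫ ω, (∑ j ∈ B, g j ω) + b ∂μ) * (∫ ω, ((∑ i ∈ A, f i ω) + a) * ((∑ k ∈ C, h k ω) + c) ∂μ) -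
        (∫ ω, (∑ k ∈ C, h k ω) + c ∂μ) * (∫ ω, ((∑ i ∈ A, f i ω) + a) * ((∑ j ∈ B, g j ω) + b) ∂μ) +
        2 * ((∫ ω, (∑ i ∈ A, f i ω) + a ∂μ) * (∫ ω, (∑ j ∈ B, g j ω) + b ∂μ) *
          (∫ ω, (∑ k ∈ C, h k ω) + c ∂μ)) =
      ∑ i ∈ A, ∑ j ∈ B, ∑ k ∈ C,
        ((∫ ω, f i ω * g j ω * h k ω ∂μ) - (∫ ω, f i ω ∂μ) * (∫ ω, g j ω * h k ω ∂μ) -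
          (∫ ω, g j ω ∂μ) * (∫ ω, f i ω * h k ω ∂μ) - (∫ ω, h k ω ∂μ) * (∫ ω, f i ω * g j ω ∂μ) +
          2 * ((∫ ω, f i ω ∂μ) * (∫ ω, g j ω ∂μ) * (∫ ω, h k ω ∂μ))) := by
  have hFm : Measurable fun ω => ∑ i ∈ A, f i ω := Finset.measurable_sum A hf
  have hGm : Measurable fun ω => ∑ j ∈ B, g j ω := Finset.measurable_sum B hg
  have hHm : Measurable fun ω => ∑ k ∈ C, h k ω := Finset.measurable_sum C hh
  have hA : (A.card : ℝ) * M ≤ (A.card + B.card + C.card : ℝ) * M :=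
    mul_le_mul_of_nonneg_right (by norm_cast; omega) hM
  have hB : (B.card : ℝ) * M ≤ (A.card + B.card + C.card : ℝ) * M :=
    mul_le_mul_of_nonneg_right (by norm_cast; omega) hM
  have hC : (C.card : ℝ) * M ≤ (A.card + B.card + C.card : ℝ) * M :=
    mul_le_mul_of_nonneg_right (by norm_cast; omega) hM
  have hFb : ∀ ω, |∑ i ∈ A, f i ω| ≤ (A.card + B.card + C.card : ℝ) * M := fun ω =>
    (abs_finset_sum_le_card_mul A f hfb ω).trans hA
  have hGb : ∀ ω, |∑ j ∈ B, g j ω| ≤ (A.card + B.card + C.card : ℝ) * M := fun ω =>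
    (abs_finset_sum_le_card_mul B g hgb ω).trans hB
  have hHb : ∀ ω, |∑ k ∈ C, h k ω| ≤ (A.card + B.card + C.card : ℝ) * M := fun ω =>
    (abs_finset_sum_le_card_mul C h hhb ω).trans hC
  have e0 :
      (∫ ω, ((∑ i ∈ A, f i ω) + a) * ((∑ j ∈ B, g j ω) + b) * ((∑ k ∈ C, h k ω) + c) ∂μ) -
          (∫ ω, (∑ i ∈ A, f i ω) + a ∂μ) * (∫ ω, ((∑ j ∈ B, g j ω) + b) * ((∑ k ∈ C, h k ω) + c) ∂μ) -
          (∫ ω, (∑ j ∈ B, g j ω) + b ∂μ) * (∫ ω, ((∑ i ∈ A, f i ω) + a) * ((∑ k ∈ C, h k ω) + c) ∂μ) -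
          (∫ ω, (∑ k ∈ C, h k ω) + c ∂μ) * (∫ ω, ((∑ i ∈ A, f i ω) + a) * ((∑ j ∈ B, g j ω) + b) ∂μ) +
          2 * ((∫ ω, (∑ i ∈ A, f i ω) + a ∂μ) * (∫ ω, (∑ j ∈ B, g j ω) + b ∂μ) *
            (∫ ω, (∑ k ∈ C, h k ω) + c ∂μ)) =
        (∫ ω, (∑ i ∈ A, f i ω) * (∑ j ∈ B, g j ω) * (∑ k ∈ C, h k ω) ∂μ) -
          (∫ ω, ∑ i ∈ A, f i ω ∂μ) * (∫ ω, (∑ j ∈ B, g j ω) * (∑ k ∈ C, h k ω) ∂μ) -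
          (∫ ω, ∑ j ∈ B, g j ω ∂μ) * (∫ ω, (∑ i ∈ A, f i ω) * (∑ k ∈ C, h k ω) ∂μ) -
          (∫ ω, ∑ k ∈ C, h k ω ∂μ) * (∫ ω, (∑ i ∈ A, f i ω) * (∑ j ∈ B, g j ω) ∂μ) +
          2 * ((∫ ω, ∑ i ∈ A, f i ω ∂μ) * (∫ ω, ∑ j ∈ B, g j ω ∂μ) * (∫ ω, ∑ k ∈ C, h k ω ∂μ)) :=
    k3_add_const hFm hGm hHm hFb hGb hHb a b c
  rw [e0]
  exact k3_sum₃ A B C f g h hf hg hh hfb hgb hhb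

end Summit.QuantumFields.YangMills.Cruxes.NT.StrongCouplingRung.CumulantAlgebra

end
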